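import Summits.Ventures.PercRepro.ProfileFlatUpset
import Summits.Ventures.PercRepro.ProfilePointedAvoidRow

/-!
# PercRepro — (D-gen): THEOREM A FOR THE BI-INDEPENDENT SETS WHOSE COMPLEMENT'S CLOSURE AVOIDS AN UP-SET OF FLATS —
THE UP-SET GENERALISATION OF CONJECTURE (D), AND THE BRIDGE (D-gen) ⟹ (D) (p10, gen 25)

For a finite matroid `M` on `n` elements and an up-set `U` of its flats let `avoidUpCount M U k` be the number of
bi-independent `k`-sets `X` with `cl(E ∖ X) ∉ U`.  At the modular cut of a point `p` of a one-element extension `M′`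
(`M = M′ ∖ p`, `U = modCut M′ p`) this is exactly the `p`-avoiding profile `out_k(M′, p)`
(`avoidUpCount_modCut_eq_outCount`).  **CONJECTURE (D-gen)** (`AvoidRowUpset`, NOT asserted): for EVERY up-set `U` of
flats, `(n − k)·avoidUpCount M U k ≤ (k + 1)·avoidUpCount M U (k + 1)` for `2k + 1 ≤ n` — Theorem A's monotonicity
for the family; `U = ∅` is Theorem A, modular cuts are conjecture (D).  DATA (paper): 0 violations on every up-set with
at most 4 generators of every matroid on ≤ 6 elements (459,556 up-sets at `n = 6`), on random up-sets at `n = 7, 8`,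
on `M(K_{2,m})` at the principal up-set of the cross line (the witness that refuted gen 18's first-moment conjecture (G))
⊕ up to 300 coloops for `m ≤ 9`; it FAILS for arbitrary (non-up-closed) families of flats.
`avoidRow_of_avoidRowUpset` — **(D-gen) ⟹ (D)**.  Nothing here asserts (D-gen), (D) or (Ĉ).
-/

open scoped Matroid

namespace PercRepro.Cogirth

open Finset ThmH Skew

variable {α : Type} [DecidableEq α] {M : Matroid α} [M.Finite]

/-- The bi-independent `k`-sets whose complement's closure avoids the family `U`. -/
noncomputable def avoidUpCount (M : Matroid α) [M.Finite] (U : Finset (Finset α)) (k : ℕ) : ℕ :=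
  ((biIndepSets M k).filter (fun X => clF M (gr M \ X) ∉ U)).card

/-- **CONJECTURE (D-gen) (NOT asserted)**: for every finite matroid on `α` and every up-set `U` of its flats,
`(n − k)·avoidUpCount M U k ≤ (k + 1)·avoidUpCount M U (k + 1)` for `2k + 1 ≤ n`. -/
def AvoidRowUpset (α : Type) [DecidableEq α] : Prop :=
  ∀ (M : Matroid α) [M.Finite] (U : Finset (Finset α)), UpFlats M U → ∀ k : ℕ, 2 * k + 1 ≤ (gr M).card →
    ((gr M).card - k) * avoidUpCount M U k ≤ (k + 1) * avoidUpCount M U (k + 1)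

/-- **THE BRIDGE**: at the modular cut of `p`, the avoiding count of the deletion is the `p`-avoiding profile:
`avoidUpCount (M ∖ p) (modCut M p) k = out_k(M, p)`. -/
theorem avoidUpCount_modCut_eq_outCount {p : α} (hp : p ∈ gr M) (k : ℕ) :
    avoidUpCount (M ＼ ({p} : Set α)) (modCut M p) k = outCount M k p := by
  unfold avoidUpCount outCount
  apply card_bij (fun X _ => X)
  · intro X hX
    rw [mem_filter, mem_biIndepSets, gr_delete] at hX
    obtain ⟨⟨hXg, hXc, hXr, hXd⟩, hcl⟩ := hX
    have hpX : p ∉ X := fun h => (mem_erase.1 (hXg h)).1 rfl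
    have hXg' : X ⊆ gr M := hXg.trans (erase_subset p _)
    have hcomp : (gr M).erase p \ X ⊆ (gr M).erase p := sdiff_subset
    have hpc : p ∉ (gr M).erase p \ X := fun h => (mem_erase.1 (mem_sdiff.1 h).1).1 rfl
    rw [rk_delete hXg' hpX] at hXr
    rw [rk_delete (hcomp.trans (erase_subset p _)) hpc] at hXd
    rw [mem_filter, mem_biIndepSets]
    refine ⟨⟨hXg', hXc, hXr, ?_⟩, hpX⟩
    rw [sdiff_eq_insert_erase_sdiff_of_notMem hp hpX, rk_insert_eq_card_iff hp hpc hXd]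
    intro hcon
    apply hcl
    rw [mem_modCut, clF_delete hpc]
    refine ⟨?_, ?_, (mem_clF_erase_clF_iff (hcomp.trans (erase_subset p _)) hpc).2 hcon⟩
    · intro x hx
      rw [mem_erase] at hx ⊢
      exact ⟨hx.1, clF_subset_gr_fu _ hx.2⟩
    · rw [← clF_delete hpc]
      exact isFlatF_clF _
  · intro X₁ _ X₂ _ h
    exact h
  · intro X hX
    refine ⟨X, ?_, rfl⟩
    rw [mem_filter, mem_biIndepSets] at hX
    obtain ⟨⟨hXg, hXc, hXr, hXd⟩, hpX⟩ := hX
    have hXg' : X ⊆ (gr M).erase p := by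
      intro x hx
      rw [mem_erase]
      exact ⟨fun h => hpX (h ▸ hx), hXg hx⟩
    have hcomp : (gr M).erase p \ X ⊆ (gr M).erase p := sdiff_subset
    have hpc : p ∉ (gr M).erase p \ X := fun h => (mem_erase.1 (mem_sdiff.1 h).1).1 rfl
    rw [sdiff_eq_insert_erase_sdiff_of_notMem hp hpX] at hXd
    have hSi : rk M ((gr M).erase p \ X) = ((gr M).erase p \ X).card := by
      have hind : M.Indep ((insert p ((gr M).erase p \ X) : Finset α) : Set α) := indep_of_rk_eq_card' hXd
      apply rk_eq_card_of_indep
      exact hind.subset (by rw [coe_insert]; exact Set.subset_insert _ _)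
    rw [rk_insert_eq_card_iff hp hpc hSi] at hXd
    rw [mem_filter, mem_biIndepSets, gr_delete]
    refine ⟨⟨hXg', hXc, ?_, ?_⟩, ?_⟩
    · rw [rk_delete hXg hpX]; exact hXr
    · rw [rk_delete (hcomp.trans (erase_subset p _)) hpc]; exact hSi
    · rw [mem_modCut, clF_delete hpc]
      rintro ⟨_, _, hcon⟩
      exact hXd ((mem_clF_erase_clF_iff (hcomp.trans (erase_subset p _)) hpc).1 hcon)

/-- **(D-gen) ⟹ (D)**: conjecture (D) for every pointed matroid on `α` follows from (D-gen) at the modular cuts. -/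
theorem avoidRow_of_avoidRowUpset (h : AvoidRowUpset α) : AvoidRow α := by
  intro M _ p k hp hk
  have h1 := h (M ＼ ({p} : Set α)) (modCut M p) (upFlats_modCut p) k (by rw [card_gr_delete hp]; omega)
  rw [avoidUpCount_modCut_eq_outCount hp, avoidUpCount_modCut_eq_outCount hp, card_gr_delete hp] at h1
  rwa [show (gr M).card - k - 1 = (gr M).card - 1 - k by omega]

end PercRepro.Cogirth
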